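import Summits.QuantumFields.YangMills.Theses.SqueezedSkewness
import Summits.QuantumFields.YangMills.Theorems.SqueezedSkewnessSpectralIdentificationLJointDiagonal
import HarnessLib

/-!
# Route `SqueezedSkewness`, crux `SpectralIdentificationL` (stmt-QuantumFields-22796), birth skeleton LINE 2 «low-pass floor»:
# the REGISTERED STUB `stub_jointDiagonal` BY NAME AND SIGNATURE

This file reproduces VERBATIM (in its own namespace, to avoid clashing with the in-tree skeleton module) the name-keyed statements `__Registered.stub_osData`, `__Registered.stub_jointDiagonal` and the composition
`SpectralIdentificationL_of` of the registered birth skeleton `Cruxes/NT/Lines/spectral_identification_l_birth.lean` (planner ym-idea-6 g8,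
@10f0581f9f6c) and proves the registered STUB `theorem stub_jointDiagonal : __Registered.stub_jointDiagonal` from the landed content
`Theorems.SqueezedSkewnessJointDiagonal.jointDiagonal_l2` (isotypic projections of `(ℤ/(2L+1))³`, compact self-adjoint eigenbases of
`P Π_q`, Parseval, countable support embedded in `ℕ`).  With it the crux is `SpectralIdentificationL ⇐ stub_osData` only
(`spectralIdentificationL_of_osData`).

Seat `ym-line-fcl-p3` g14 (cell ym-idea-1; free hands).  HONEST FRAMING: `stub_osData` (L: the Osterwalder–Schrader / transfer-operator datum
on `ℓ²(ℕ)` with the thermal-limit covariance identity) is NOT proved here; no crux, route, NT statement, thermal limit or mass gap is proved.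
References: M. Reed, B. Simon, *Methods of Modern Mathematical Physics I* (1980), Thm. VI.16 [cite: ReedSimonI1980, Thm. VI.16].
-/

set_option autoImplicit false

namespace Summit.QuantumFields.YangMills.Theorems.SqueezedSkewnessSpectralIdentificationLStub

open Summit.QuantumFields.YangMills.Theses.SqueezedSkewness

/-! ## Name-keyed statements of the two registered stubs (verbatim from the birth skeleton) -/
namespace __Registered

/-- Statement of `stub_osData` (L): OS / transfer-operator data on ℓ²(ℕ) with the thermal-limit covariance identity. -/
abbrev stub_osData : Prop :=
  ∀ (G : Type) [Group G] [TopologicalSpace G] [IsTopologicalGroup G] [CompactSpace G], letI : MeasurableSpace G := borel G; haveI : BorelSpace G := ⟨rfl⟩; ∀ (r : Literature.MathematicalPhysics.QuantumFieldTheory.LatticeRep G), let St : ℕ → ℕ → Type := fun S T => Literature.MathematicalPhysics.QuantumFieldTheory.FinTorusSite S S S T; let Cfg : ℕ → ℕ → Type := fun S T => Literature.MathematicalPhysics.QuantumFieldTheory.FinTorusSite S S S T × Fin 4 → G; let cc : (n : ℕ) → Fin n → ℤ := fun n i => if 2 * i.val < n then (i.val : ℤ) else (i.val : ℤ) - n;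 let posE : (S T : ℕ) → St S T → EuclideanSpace ℝ (Fin 4) := fun S T x => Literature.MathematicalPhysics.QuantumLattice.siteToE (d := 4) ![cc T x.2.2.2, cc S x.1, cc S x.2.1, cc S x.2.2.1]; let P : (S T : ℕ) → St S T → Fin 4 → Fin 4 → Cfg S T → ℝ := fun _ _ x i j U => (r.ρ (Literature.MathematicalPhysics.QuantumFieldTheory.finTorusPlaquette U x i j)).trace.re; let A : (S T : ℕ) → St S T → Cfg S T → ℝ := fun S T x U => ∑ q : {q : Fin 4 × Fin 4 // q.1 < q.2}, P S T x q.1.1 q.1.2 U; let w : ℝ → (S T : ℕ) → Cfg S T → ℝ := fun β S T U => Real.exp (-β * ∑ x : St S T, ∑ q : {q : Fin 4 × Fin 4 // q.1 < q.2}, ((r.N : ℝ) - P S T x q.1.1 q.1.2 U)); let E : ℝ → (S T : ℕ) → (Cfg S T → ℝ) → ℝ := fun β S T F => (∫ U : Literature.MathematicalPhysics.QuantumFieldTheory.FinTorusSite S S S T × Fin 4 → G, F U * w β S T U ∂MeasureTheory.Measure.pi (fun _ => Literature.MathematicalPhysics.QuantumFieldTheory.haarProbability G)) / Literature.MathematicalPhysics.QuantumFieldTheory.wilsonFinTorusPartition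 r.ρ β S S S T; let Cov : ℝ → (S T : ℕ) → (Cfg S T → ℝ) → (Cfg S T → ℝ) → ℝ := fun β S T F F' => E β S T (fun U => F U * F' U) - E β S T F * E β S T F'; let refl : (S T : ℕ) → Cfg S T → Cfg S T := fun _ T U e => if e.2 = Fin.last 3 then (U ((e.1.1, e.1.2.1, e.1.2.2.1, Fin.rev e.1.2.2.2), Fin.last 3))⁻¹ else U ((e.1.1, e.1.2.1, e.1.2.2.1, ⟨(T - e.1.2.2.2.val) % T, Nat.mod_lt _ e.1.2.2.2.pos⟩), e.2); let B : (S T : ℕ) → ℝ → SchwartzMap (EuclideanSpace ℝ (Fin 4)) ℝ → Cfg S T → ℝ := fun S T s f U => ∑ x : St S T, f (s • posE S T x) * A S T x U; let Qrp : ℝ → (S T : ℕ) → ℝ → SchwartzMap (EuclideanSpace ℝ (Fin 4)) ℝ → ℝ := fun β S T s f => Cov β S T (fun U => B S T s f (refl S T U)) (B S T s f); ∀ (β : ℝ) (L : ℕ) (s : ℝ), 0 ≤ β → 1 ≤ L → 0 < s → ∃ (P : lp (fun _ : ℕ => ℂ) 2 →L[ℂ] lp (fun _ : ℕ => ℂ)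 2) (U : (Fin 3 → ℤ) → (lp (fun _ : ℕ => ℂ) 2 →L[ℂ] lp (fun _ : ℕ => ℂ) 2)) (ψ₀ : lp (fun _ : ℕ => ℂ) 2), (IsSelfAdjoint P ∧ IsCompactOperator P ∧ ‖P‖ ≤ 1 ∧ (∀ v : lp (fun _ : ℕ => ℂ) 2, 0 ≤ RCLike.re (inner ℂ (P v) v)) ∧ U 0 = 1 ∧ (∀ x y : Fin 3 → ℤ, U (x + y) = U x * U y) ∧ (∀ x y : Fin 3 → ℤ, (∀ i, ((x i : ℤ) : ZMod (2 * L + 1)) = ((y i : ℤ) : ZMod (2 * L + 1))) → U x = U y) ∧ (∀ (x : Fin 3 → ℤ) (v : lp (fun _ : ℕ => ℂ) 2), ‖U x v‖ = ‖v‖) ∧ (∀ x : Fin 3 → ℤ, P * U x = U x * P)) ∧ ∀ (H : ℝ) (f : SchwartzMap (EuclideanSpace ℝ (Fin 4)) ℝ), tsupport (f : EuclideanSpace ℝ (Fin 4) → ℝ) ⊆ {y : EuclideanSpace ℝ (Fin 4) | 0 < y 0 ∧ y 0 ≤ H} → tsupport (f : EuclideanSpace ℝ (Fin 4) → ℝ)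 ⊆ {y : EuclideanSpace ℝ (Fin 4) | ∀ i : Fin 3, |y i.succ| < s * (L + 1 / 2)} → Filter.Tendsto (fun k : ℕ => Qrp β (2 * L + 1) (2 ^ k * (2 * L + 1)) s f) Filter.atTop (nhds (‖(∑' x : Fin 4 → ℤ, ((f (s • Literature.MathematicalPhysics.QuantumLattice.siteToE (d := 4) x) : ℝ) : ℂ) • ((P ^ (Int.toNat (x 0 - 1))) ((U (fun i : Fin 3 => x i.succ)) ψ₀)))‖ ^ 2))

/-- Statement of `stub_jointDiagonal` (M): joint diagonalisation of (P, U) and Parseval ⇒ the Källén–Lehmann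
`HasSum` with reciprocal-lattice momenta, for every admissible test function. -/
abbrev stub_jointDiagonal : Prop :=
  ∀ (L : ℕ) (s : ℝ), 1 ≤ L → 0 < s → ∀ (P : lp (fun _ : ℕ => ℂ) 2 →L[ℂ] lp (fun _ : ℕ => ℂ) 2) (U : (Fin 3 → ℤ) → (lp (fun _ : ℕ => ℂ) 2 →L[ℂ] lp (fun _ : ℕ => ℂ) 2)) (ψ₀ : lp (fun _ : ℕ => ℂ) 2), IsSelfAdjoint P ∧ IsCompactOperator P ∧ ‖P‖ ≤ 1 ∧ (∀ v : lp (fun _ : ℕ => ℂ) 2, 0 ≤ RCLike.re (inner ℂ (P v) v)) ∧ U 0 = 1 ∧ (∀ x y : Fin 3 → ℤ, U (x + y) = U x * U y) ∧ (∀ x y : Fin 3 → ℤ, (∀ i, ((x i : ℤ) : ZMod (2 * L + 1)) = ((y i : ℤ) : ZMod (2 * L + 1))) → U x = U y) ∧ (∀ (x : Fin 3 → ℤ) (v : lp (fun _ : ℕ => ℂ) 2), ‖U x v‖ = ‖v‖) ∧ (∀ x : Fin 3 → ℤ, P * U x = U x * P) → ∃ (W μ : ℕ → ℝ) (q : ℕ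 → Fin 3 → ℤ), (∀ n, 0 ≤ W n) ∧ (∀ n, 0 ≤ μ n ∧ μ n ≤ 1) ∧ ∀ (H : ℝ) (f : SchwartzMap (EuclideanSpace ℝ (Fin 4)) ℝ), tsupport (f : EuclideanSpace ℝ (Fin 4) → ℝ) ⊆ {y : EuclideanSpace ℝ (Fin 4) | 0 < y 0 ∧ y 0 ≤ H} → tsupport (f : EuclideanSpace ℝ (Fin 4) → ℝ) ⊆ {y : EuclideanSpace ℝ (Fin 4) | ∀ i : Fin 3, |y i.succ| < s * (L + 1 / 2)} → HasSum (fun n : ℕ => W n * ‖(∑' x : Fin 4 → ℤ, (((f (s • Literature.MathematicalPhysics.QuantumLattice.siteToE (d := 4) x) * μ n ^ (Int.toNat (x 0 - 1))) : ℝ) : ℂ) * Complex.exp (Complex.I * ((s * ∑ k : Fin 3, (2 * Real.pi * (q n k : ℝ) / (s * (2 * L + 1))) * (x k.succ : ℝ) : ℝ) : ℂ)))‖ ^ 2) (‖(∑' x : Fin 4 → ℤ, ((f (s • Literature.MathematicalPhysics.QuantumLattice.siteToE (d := 4) x) : ℝ) : ℂ) • ((P ^ (Int.toNat (x 0 - 1)))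 ((U (fun i : Fin 3 => x i.succ)) ψ₀)))‖ ^ 2)

end __Registered

/-! ## The registered STUB `stub_jointDiagonal`, by name and signature -/

/-- **STUB `stub_jointDiagonal` HOLDS** (pure operator theory): joint diagonalisation of the compact positive contraction `P` with the
commuting norm-preserving representation `U` of `ℤ³` through `(ℤ/(2L+1))³`, and Parseval — `Theorems.SqueezedSkewnessJointDiagonal.jointDiagonal_l2`.
[cite: ReedSimonI1980, Thm. VI.16] -/
theorem stub_jointDiagonal : __Registered.stub_jointDiagonal :=
  Summit.QuantumFields.YangMills.Theorems.SqueezedSkewnessJointDiagonal.jointDiagonal_l2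

/-! ## Composition (verbatim from the birth skeleton): the crux BY NAME from the two stub statements -/

/-- **SpectralIdentificationL_of** — conclusion = the route decl
`Summit.QuantumFields.YangMills.Theses.SqueezedSkewness.SpectralIdentificationL`, by name. -/
theorem SpectralIdentificationL_of (h1 : __Registered.stub_osData)
    (h2 : __Registered.stub_jointDiagonal) :
    SpectralIdentificationL := by
  intro G _ _ _ _ r St Cfg cc posE Pl A w E Cov refl B Qrp amp β L s hβ hL hs
  obtain ⟨P', U, ψ₀, hprops, hlim⟩ := h1 G r β L s hβ hL hs
  obtain ⟨W, μ, q, hW, hμ, hsum⟩ := h2 L s hL hs P' U ψ₀ hprops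
  refine ⟨W, μ, q, hW, hμ, fun H f hf1 hf2 => ⟨_, hlim H f hf1 hf2, ?_⟩⟩
  exact hsum H f hf1 hf2

/-- **THE CRUX MODULO `stub_osData` ONLY**: `SpectralIdentificationL ⇐ stub_osData` (the joint-diagonalisation stub discharged).
[cite: ReedSimonI1980, Thm. VI.16] -/
theorem spectralIdentificationL_of_osData (h1 : __Registered.stub_osData) : SpectralIdentificationL :=
  SpectralIdentificationL_of h1 stub_jointDiagonal

end Summit.QuantumFields.YangMills.Theorems.SqueezedSkewnessSpectralIdentificationLStub
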